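import Literature.AlgebraicGeometry.Resolution.AffineModelLU
import Literature.AlgebraicGeometry.Resolution.RegularLocalRingsNormal
import Literature.AlgebraicGeometry.Resolution.DimensionFormula
import Mathlib.RingTheory.Polynomial.Subring
import HarnessLib

/-!
# Local models of a dominating valuation: centre, residue algebraicity, dimension, base change

Topic: `Literature/AlgebraicGeometry/Resolution`. Bookkeeping for Cossart–Piltant's local
uniformization property (LU) of a local domain `(A, 𝔪, k)` (`CPLocalUniformization`,
`ArithmeticalThreefolds.lean`: for a valuation ring `O ⊇ A` of `K = Frac A` dominating `A` with
residue field algebraic over `k`, a finitely generated model `T = A[s] ⊆ O` is sought whose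
localisation at the centre `P = 𝔪_O ∩ T` is regular), as consumed by the reduction of (LU) for
complete local domains to the local theorem (`CossartPiltant2019ReductionP`,
`ArithmeticalThreefoldsLocal.lean`; Cossart–Piltant 2019, proof of Prop. 4.10 = arXiv v1
Prop. 4.8), where the local theorem is re-applied to the local rings `T_P` of such models and
(LU) is first established for models over the complete regular local subring `S ⊆ A` of Cohen's
structure theorem:

* `under_eq_maximalIdeal_of_forall_valuation_lt_one`, `liesOver_maximalIdeal_…` — the centre
  `P` (cut out by `v < 1`) lies over `𝔪` (domination; units of `A` have value `1`);
* `isAlgebraic_quotient_of_forall_valuation_lt_one` — the elementary residue hypothesis of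
  `CPLocalUniformization` makes `T/P` algebraic over `k`;
* `ringKrullDim_localization_centre_eq` (`_le`) — hence **`dim T_P = dim A`** when `A` is
  universally catenary (resp. `≤` for `A` Noetherian), by the dimension formula
  (`DimensionFormula.lean`, Matsumura Thms. 15.5/15.6); `mem_comap_inclusion_maximalIdeal_iff`
  identifies the centre of `CPLocalUniformization` with `v < 1`;
* `exists_adjoin_isRegularLocalRing_of_isIntegral` — **integral base change**: if `A` is
  integral over `S` and `T = S[t] ⊆ O` has `Frac T = K` and `T_P` regular, then `A[t] ⊆ O` and
  `A[t]_{𝔪_O ∩ A[t]} = T_P` is regular (regular local rings are normal, Matsumura Thm. 19.4,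
  `RegularLocalRingsNormal.lean`, so `A ⊆ T_P`; then the sandwich `T ⊆ A[t] ⊆ T_P`,
  `AffineModelLU.lean`) — the passage from (LU) over the Cohen subring `S` to (LU) for `A`;
* `cpLocalUniformization_of_fractionField'` — (LU) may be checked in one fraction field,
  keeping the residue hypothesis (variant of `cpLocalUniformization_of_fractionField`).

Everything is PROVED; no named facts are introduced.

## Sources

* V. Cossart, O. Piltant, J. Algebra 529 (2019) 268–535 = arXiv:1412.0868, §4.1 (LU) and the
  proof of Prop. 4.10 (arXiv v1: Prop. 4.8, pp. 53–54). [CossartPiltant2019]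
* H. Matsumura, *Commutative Ring Theory*, CUP 1986, Thms. 15.5, 15.6, 19.4. [Matsumura1987]
-/

noncomputable section

open IsLocalRing Polynomial

namespace Literature.AlgebraicGeometry.Resolution

universe u

/-! ## The centre of a dominating valuation on a model, and its residue ring -/

section Centre

variable {A K : Type u} [CommRing A] [IsLocalRing A] [Field K] [Algebra A K]
  (O : ValuationSubring K)

/-- **The centre lies over the maximal ideal.** Let `(A, 𝔪)` be a local ring mapping into a
valuation ring `O` of a field `K` which dominates it (`v(a) < 1` for `a ∈ 𝔪`). For any
`A`-subalgebra `T ⊆ K` and any ideal `P` of `T` cut out by `v < 1` (the centre `𝔪_O ∩ T` when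
`T ⊆ O`), `P ∩ A = 𝔪`: units of `A` have value `1`. [cite: CossartPiltant2019, §4.1 (LU)] -/
theorem under_eq_maximalIdeal_of_forall_valuation_lt_one (hAO : ∀ a : A, algebraMap A K a ∈ O)
    (hdom : ∀ a ∈ maximalIdeal A, O.valuation (algebraMap A K a) < 1) (T : Subalgebra A K)
    (P : Ideal T) (hP : ∀ x : T, x ∈ P ↔ O.valuation (x : K) < 1) :
    P.under A = maximalIdeal A := by
  ext a
  rw [Ideal.under_def, Ideal.mem_comap, hP]
  change O.valuation (algebraMap A K a) < 1 ↔ _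
  constructor
  · intro hlt
    by_contra hna
    have hu : IsUnit a := by
      by_contra hnu
      exact hna ((IsLocalRing.mem_maximalIdeal a).mpr hnu)
    obtain ⟨b, hb⟩ := hu.exists_right_inv
    have h1 : O.valuation (algebraMap A K a) = 1 :=
      valuation_eq_one_of_mul_eq_one O (hAO a) (hAO b) (by rw [← map_mul, hb, map_one])
    exact (lt_irrefl _) (h1 ▸ hlt)
  · exact hdom a

/-- Hence the centre lies over `𝔪` (as an instance-shaped statement). [folklore] -/
theorem liesOver_maximalIdeal_of_forall_valuation_lt_one (hAO : ∀ a : A, algebraMap A K a ∈ O)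
    (hdom : ∀ a ∈ maximalIdeal A, O.valuation (algebraMap A K a) < 1) (T : Subalgebra A K)
    (P : Ideal T) (hP : ∀ x : T, x ∈ P ↔ O.valuation (x : K) < 1) :
    P.LiesOver (maximalIdeal A) :=
  ⟨(under_eq_maximalIdeal_of_forall_valuation_lt_one O hAO hdom T P hP).symm⟩

/-- **The residue ring of the centre is algebraic over the residue field.** If, as in
Cossart–Piltant's (LU) (`CPLocalUniformization`), every element of `O` is a root modulo `𝔪_O`
of a polynomial over `A` not all of whose coefficients lie in `𝔪` (i.e. the residue field of
`O` is algebraic over `k = A/𝔪`), then for every `A`-subalgebra `T ⊆ O` with centre `P`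
(`v < 1`) over `𝔪`, the domain `T/P ⊆ 𝒪_v/𝔪_v` is algebraic over `k`.
[cite: CossartPiltant2019, §4.1 (LU)] -/
theorem isAlgebraic_quotient_of_forall_valuation_lt_one
    (halg : ∀ x : O, ∃ p : Polynomial A, (∃ i, p.coeff i ∉ maximalIdeal A) ∧
      O.valuation (p.eval₂ (algebraMap A K) x) < 1)
    (T : Subalgebra A K) (hTO : ∀ x : T, (x : K) ∈ O) (P : Ideal T)
    (hP : ∀ x : T, x ∈ P ↔ O.valuation (x : K) < 1) [P.LiesOver (maximalIdeal A)] :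
    Algebra.IsAlgebraic (A ⧸ maximalIdeal A) (T ⧸ P) := by
  refine ⟨fun y => ?_⟩
  obtain ⟨x, rfl⟩ := Ideal.Quotient.mk_surjective y
  obtain ⟨q, ⟨i, hi⟩, hv⟩ := halg ⟨x, hTO x⟩
  -- `q(x) ∈ P`
  have hqx : aeval x q ∈ P := by
    rw [hP]
    have : ((aeval x q : T) : K) = q.eval₂ (algebraMap A K) (x : K) := by
      rw [← Subalgebra.aeval_coe, Polynomial.aeval_def]
    rw [this]
    exact hv
  refine ⟨q.map (algebraMap A (A ⧸ maximalIdeal A)), ?_, ?_⟩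
  · intro h0
    apply hi
    have := congrArg (fun r => r.coeff i) h0
    simp only [Polynomial.coeff_map, Polynomial.coeff_zero] at this
    exact Ideal.Quotient.eq_zero_iff_mem.mp this
  · rw [Polynomial.aeval_map_algebraMap]
    have h := Polynomial.aeval_algHom_apply (Ideal.Quotient.mkₐ A P) x q
    rw [Ideal.Quotient.mkₐ_eq_mk] at h
    rw [h, Ideal.Quotient.eq_zero_iff_mem]
    exact hqx

end Centre

/-! ## Dimension of local models -/

section Dimension

variable {A K : Type u} [CommRing A] [IsDomain A] [IsLocalRing A] [Field K] [Algebra A K]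
  [IsFractionRing A K] (O : ValuationSubring K)

/-- **`dim T_P = dim A` for local models of a dominating, residually algebraic valuation**
(the dimension formula, Matsumura Thm. 15.6, in the setting of Cossart–Piltant's (LU),
`CPLocalUniformization`): `A` a universally catenary local domain (e.g. complete, or
essentially of finite type over a field) with fraction field `K`, `O ⊇ A` a valuation ring of
`K` dominating `A` with residue field algebraic over `A/𝔪`, `T = A[s] ⊆ O` finitely generated,
`P = 𝔪_O ∩ T`. Then `dim T_P = dim A`. (This is what lets Cossart–Piltant re-apply the local
theorem, which needs dimension three, to local uniformizations `T_P` in the proof of Prop. 4.10.)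
[cite: Matsumura1987, Thm. 15.6] [cite: CossartPiltant2019, proof of Prop. 4.10 (arXiv v1: Prop. 4.8)] -/
theorem ringKrullDim_localization_centre_eq (hA : IsUniversallyCatenaryRing A)
    (hAO : ∀ a : A, algebraMap A K a ∈ O)
    (hdom : ∀ a ∈ maximalIdeal A, O.valuation (algebraMap A K a) < 1)
    (halg : ∀ x : O, ∃ p : Polynomial A, (∃ i, p.coeff i ∉ maximalIdeal A) ∧
      O.valuation (p.eval₂ (algebraMap A K) x) < 1)
    (s : Finset K) (hTO : ∀ x : Algebra.adjoin A (s : Set K), (x : K) ∈ O)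
    (P : Ideal (Algebra.adjoin A (s : Set K))) [P.IsPrime]
    (hP : ∀ x : Algebra.adjoin A (s : Set K), x ∈ P ↔ O.valuation (x : K) < 1) :
    ringKrullDim (Localization.AtPrime P) = ringKrullDim A := by
  haveI := liesOver_maximalIdeal_of_forall_valuation_lt_one O hAO hdom _ P hP
  haveI := isAlgebraic_quotient_of_forall_valuation_lt_one O halg _ hTO P hP
  exact ringKrullDim_localization_adjoin_eq_of_isUniversallyCatenaryRing hA s P

/-- Without universal catenarity: `dim T_P ≤ dim A` (Matsumura Thm. 15.5). [cite: Matsumura1987, Thm. 15.5] -/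
theorem ringKrullDim_localization_centre_le [IsNoetherianRing A]
    (hAO : ∀ a : A, algebraMap A K a ∈ O)
    (hdom : ∀ a ∈ maximalIdeal A, O.valuation (algebraMap A K a) < 1)
    (halg : ∀ x : O, ∃ p : Polynomial A, (∃ i, p.coeff i ∉ maximalIdeal A) ∧
      O.valuation (p.eval₂ (algebraMap A K) x) < 1)
    (s : Finset K) (hTO : ∀ x : Algebra.adjoin A (s : Set K), (x : K) ∈ O)
    (P : Ideal (Algebra.adjoin A (s : Set K))) [P.IsPrime]
    (hP : ∀ x : Algebra.adjoin A (s : Set K), x ∈ P ↔ O.valuation (x : K) < 1) :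
    ringKrullDim (Localization.AtPrime P) ≤ ringKrullDim A := by
  haveI := liesOver_maximalIdeal_of_forall_valuation_lt_one O hAO hdom _ P hP
  haveI := isAlgebraic_quotient_of_forall_valuation_lt_one O halg _ hTO P hP
  haveI : FaithfulSMul A (Algebra.adjoin A (s : Set K)) :=
    (faithfulSMul_iff_algebraMap_injective _ _).mpr fun a b h =>
      IsFractionRing.injective A K (congrArg Subtype.val h)
  haveI : Algebra.FiniteType A (Algebra.adjoin A (s : Set K)) :=
    (Subalgebra.fg_iff_finiteType _).mp (Subalgebra.fg_adjoin_finset _)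
  haveI : Algebra.IsAlgebraic A K := IsLocalization.isAlgebraic K (nonZeroDivisors A)
  haveI : Algebra.IsAlgebraic A (Algebra.adjoin A (s : Set K)) :=
    Algebra.IsAlgebraic.of_injective (Algebra.adjoin A (s : Set K)).val Subtype.val_injective
  exact ringKrullDim_localization_le_of_isAlgebraic P

omit [IsDomain A] [IsLocalRing A] [IsFractionRing A K] in
/-- The centre `𝔪_O ∩ T` of `CPLocalUniformization` (the pull-back of `𝔪_O` along the
inclusion `T ⊆ O`) is cut out by `v < 1`. [folklore] -/
theorem mem_comap_inclusion_maximalIdeal_iff (T : Subalgebra A K)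
    (h : T.toSubring ≤ O.toSubring) (x : T) :
    x ∈ (Ideal.comap (Subring.inclusion h) (maximalIdeal O) : Ideal T) ↔
      O.valuation (x : K) < 1 := by
  rw [Ideal.mem_comap, ValuationSubring.valuation_lt_one_iff]
  rfl

end Dimension

/-! ## Integral base change: a regular model over `S ⊆ A` is a regular model over `A` -/

section BaseChange

variable {S A K : Type u} [CommRing S] [CommRing A] [Field K] [Algebra S A]
  [Algebra A K] [Algebra S K] [IsScalarTower S A K] [Algebra.IsIntegral S A]

/-- **Regular models over a subring pass to integral overrings.** Let `S → A` be an integral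
ring extension (e.g. `A` finite over the complete regular local ring `S` of Cohen's structure
theorem), `A → K` a field (e.g. `K = Frac A`), `O` a valuation ring of `K`, and `T = S[t] ⊆ O` a finitely
generated `S`-subalgebra of `K` with `Frac T = K` whose localisation at the centre `𝔪_O ∩ T` is
regular. Then `A[t] ⊆ O` and `A[t]` localised at its centre is the same regular local ring:
`T_P` is regular, hence normal (Matsumura Thm. 19.4), so contains `A` (integral over `S ⊆ T_P`,
inside `K = Frac T_P`), and `T ⊆ A[t] ⊆ T_P` forces `A[t]_{𝔪_O ∩ A[t]} = T_P`. (The last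
step of Cossart–Piltant's proof of Prop. 4.10, where (LU) is established for models over the
Cohen subring `S ⊆ A`.) [cite: CossartPiltant2019, proof of Prop. 4.10 (arXiv v1: Prop. 4.8)] -/
theorem exists_adjoin_isRegularLocalRing_of_isIntegral (O : ValuationSubring K) (t : Finset K)
    (ht : (Algebra.adjoin S (t : Set K)).toSubring ≤ O.toSubring)
    (hfrac : IsFractionRing (Algebra.adjoin S (t : Set K)) K)
    (hreg : IsRegularLocalRing
      (Localization.AtPrime (Ideal.comap (Subring.inclusion ht) (maximalIdeal O)))) :
    ∃ (h : (Algebra.adjoin A (t : Set K)).toSubring ≤ O.toSubring),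
      IsRegularLocalRing
        (Localization.AtPrime (Ideal.comap (Subring.inclusion h) (maximalIdeal O))) := by
  classical
  set TS : Subalgebra S K := Algebra.adjoin S (t : Set K) with hTS
  set TA : Subalgebra A K := Algebra.adjoin A (t : Set K) with hTA
  set P : Ideal TS.toSubring := Ideal.comap (Subring.inclusion ht) (maximalIdeal O) with hPdef
  haveI hPprime : P.IsPrime := Ideal.IsPrime.comap _
  haveI : IsFractionRing TS.toSubring K := hfrac
  have hPmem : ∀ x : TS.toSubring, x ∈ P ↔ O.valuation (x : K) < 1 := fun x => by
    rw [hPdef, Ideal.mem_comap, ValuationSubring.valuation_lt_one_iff]; rfl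
  -- the localisation `R = T_P ⊆ K`
  let R : Subalgebra TS.toSubring K :=
    Localization.subalgebra.ofField K P.primeCompl P.primeCompl_le_nonZeroDivisors
  haveI : IsLocalization.AtPrime R P :=
    Localization.subalgebra.isLocalization_ofField K P.primeCompl _
  have hmemR : ∀ x : K, x ∈ R ↔ ∃ (a s : TS.toSubring) (_ : s ∈ P.primeCompl),
      x = (a : K) * ((s : K))⁻¹ := fun x => mem_ofField_iff _ _ x
  -- `R` is regular, hence integrally closed, with fraction field `K`
  haveI hRreg : IsRegularLocalRing R :=
    IsRegularLocalRing.of_ringEquiv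
      (IsLocalization.algEquiv P.primeCompl (Localization.AtPrime P) R).toRingEquiv
  haveI : IsIntegrallyClosed R := isIntegrallyClosed_of_isRegularLocalRing R
  have hTSR : ∀ x : K, x ∈ TS → x ∈ R := fun x hx =>
    (hmemR x).mpr ⟨⟨x, hx⟩, 1, Submonoid.one_mem _, by simp⟩
  haveI : IsFractionRing R K := by
    refine IsFractionRing.of_field R K fun z => ?_
    obtain ⟨a, b, -, rfl⟩ := IsFractionRing.div_surjective (A := TS.toSubring) z
    exact ⟨⟨a, hTSR a a.2⟩, ⟨b, hTSR b b.2⟩, rfl⟩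
  -- `R ⊆ O`
  have hRO : ∀ x : K, x ∈ R → x ∈ O := fun x hx => by
    obtain ⟨a, s, hs, rfl⟩ := (hmemR x).mp hx
    have haO : (a : K) ∈ O := ht a.2
    have hsO : (s : K) ∈ O := ht s.2
    have hs1 : O.valuation (s : K) = 1 := by
      have hle := (O.valuation_le_one_iff _).mpr hsO
      have hnlt : ¬ O.valuation (s : K) < 1 := fun hlt => hs ((hPmem s).mpr hlt)
      exact le_antisymm hle (not_lt.mp hnlt)
    have hsinvO : ((s : K))⁻¹ ∈ O := by
      rw [← O.valuation_le_one_iff, map_inv₀, hs1, inv_one]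
    exact mul_mem haO hsinvO
  -- `A ⊆ R` by normality
  have hAR : ∀ a : A, algebraMap A K a ∈ R := by
    intro a
    letI : Algebra S R := ((algebraMap TS.toSubring R).comp
      ((algebraMap S TS : S →+* TS))).toAlgebra
    haveI : IsScalarTower S R K := IsScalarTower.of_algebraMap_eq fun c => rfl
    have hint : IsIntegral S (algebraMap A K a) :=
      (Algebra.IsIntegral.isIntegral (R := S) a).map (IsScalarTower.toAlgHom S A K)
    have hintR : IsIntegral R (algebraMap A K a) := hint.tower_top
    obtain ⟨y, hy⟩ := (isIntegrallyClosed_iff K).mp inferInstance hintR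
    rw [← hy]
    exact (y : R).2
  -- `A[t] ⊆ R`, hence `A[t] ⊆ O`
  have hTAR : ∀ x : K, x ∈ TA → x ∈ R := fun x hx => by
    refine Algebra.adjoin_induction (p := fun x _ => x ∈ R) ?_ ?_ ?_ ?_ (show x ∈ TA from hx)
    · exact fun x hx => hTSR x (Algebra.subset_adjoin hx)
    · exact fun a => hAR a
    · exact fun _ _ _ _ hx hy => add_mem hx hy
    · exact fun _ _ _ _ hx hy => mul_mem hx hy
  have h : TA.toSubring ≤ O.toSubring := fun x hx => hRO x (hTAR x hx)
  refine ⟨h, ?_⟩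
  -- `S[t] ⊆ A[t]`
  have hle : TS.toSubring ≤ TA.toSubring := by
    intro x hx
    refine Algebra.adjoin_induction (p := fun x _ => x ∈ TA) ?_ ?_ ?_ ?_ (show x ∈ TS from hx)
    · exact fun x hx => Algebra.subset_adjoin hx
    · intro c
      rw [IsScalarTower.algebraMap_apply S A K]
      exact TA.algebraMap_mem _
    · exact fun _ _ _ _ hx hy => add_mem hx hy
    · exact fun _ _ _ _ hx hy => mul_mem hx hy
  -- sandwich `S[t] ⊆ A[t] ⊆ S[t]_P`
  set P' : Ideal TA.toSubring := Ideal.comap (Subring.inclusion h) (maximalIdeal O) with hP'def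
  haveI : P'.IsPrime := Ideal.IsPrime.comap _
  have H : ∀ x : TA.toSubring, ∃ a s : TS.toSubring,
      Subring.inclusion hle s ∉ P' ∧ (x : K) * s = a := by
    intro x
    obtain ⟨a, s, hs, hx⟩ := (hmemR x).mp (hTAR x x.2)
    refine ⟨a, s, ?_, ?_⟩
    · rw [hP'def, Ideal.mem_comap, ValuationSubring.valuation_lt_one_iff]
      change ¬ O.valuation (s : K) < 1
      exact fun hlt => hs ((hPmem s).mpr hlt)
    · have hs0 : ((s : TS.toSubring) : K) ≠ 0 := fun h0 => by
        apply hs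
        have : s = 0 := Subtype.ext h0
        rw [this]
        exact P.zero_mem
      rw [hx, inv_mul_cancel_right₀ hs0]
  refine isRegularLocalRing_localization_of_sandwich hle P' P ?_ H hreg
  rw [hP'def, hPdef, Ideal.comap_comap]
  rfl

end BaseChange

/-! ## (LU) inside one fraction field, with the residue hypothesis -/

section OneFractionField

/-- **Transport, keeping the residue hypothesis.** To prove Cossart–Piltant's (LU) for a local
domain `A` it suffices to uniformize, inside ONE fraction field `K` of `A`, every valuation
ring of `K` containing `A`, dominating it and with residue field algebraic over `A/𝔪` (in the
elementary rendering of `CPLocalUniformization`); cf. `cpLocalUniformization_of_fractionField`,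
which drops the residue hypothesis. [folklore] -/
theorem cpLocalUniformization_of_fractionField' (A : Type u) [CommRing A] [IsDomain A]
    [IsLocalRing A] (K : Type u) [Field K] [Algebra A K] [IsFractionRing A K]
    (h : ∀ O : ValuationSubring K, (∀ a : A, algebraMap A K a ∈ O) →
      (∀ a ∈ maximalIdeal A, O.valuation (algebraMap A K a) < 1) →
      (∀ x : O, ∃ p : Polynomial A, (∃ i, p.coeff i ∉ maximalIdeal A) ∧
        O.valuation (p.eval₂ (algebraMap A K) x) < 1) →
        ∃ (s : Finset K) (hs : (Algebra.adjoin A (s : Set K)).toSubring ≤ O.toSubring),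
          IsRegularLocalRing (Localization.AtPrime
            (Ideal.comap (Subring.inclusion hs) (maximalIdeal O)))) :
    CPLocalUniformization A := by
  classical
  intro K' _ _ _ O hAO hdom halg
  -- the `A`-isomorphism of fraction fields
  let e : K' ≃ₐ[A] K := IsLocalization.algEquiv (nonZeroDivisors A) K' K
  let f : K →+* K' := (e.symm : K ≃ₐ[A] K').toRingEquiv.toRingHom
  have hf : ∀ x, f x = e.symm x := fun _ => rfl
  let OK : ValuationSubring K := O.comap f
  have hAOK : ∀ a : A, algebraMap A K a ∈ OK := fun a => by
    show f (algebraMap A K a) ∈ O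
    rw [hf, AlgEquiv.commutes]
    exact hAO a
  have hdomK : ∀ a ∈ maximalIdeal A, OK.valuation (algebraMap A K a) < 1 := fun a ha => by
    rw [valuation_comap_lt_one_iff, hf, AlgEquiv.commutes]
    exact hdom a ha
  have halgK : ∀ x : OK, ∃ p : Polynomial A, (∃ i, p.coeff i ∉ maximalIdeal A) ∧
      OK.valuation (p.eval₂ (algebraMap A K) x) < 1 := fun x => by
    have hxO : f (x : K) ∈ O := x.2
    obtain ⟨p, hp, hv⟩ := halg ⟨f x, hxO⟩
    refine ⟨p, hp, ?_⟩
    rw [valuation_comap_lt_one_iff, Polynomial.hom_eval₂]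
    have hfA : f.comp (algebraMap A K) = algebraMap A K' := by
      ext a
      simp only [RingHom.coe_comp, Function.comp_apply, hf, AlgEquiv.commutes]
    rw [hfA]
    exact hv
  obtain ⟨s, hs, hreg⟩ := h OK hAOK hdomK halgK
  -- transport the uniformizing algebra back to `K'`
  let T : Subalgebra A K := Algebra.adjoin A (s : Set K)
  let T' : Subalgebra A K' := Algebra.adjoin A ((s.image e.symm : Finset K') : Set K')
  have hT' : T' = T.map (e.symm : K →ₐ[A] K') := by
    simp only [T', T, Finset.coe_image, AlgHom.map_adjoin]
    rfl
  have hs' : T'.toSubring ≤ O.toSubring := by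
    intro x hx
    have hx' : x ∈ T.map (e.symm : K →ₐ[A] K') := hT' ▸ hx
    obtain ⟨y, hy, rfl⟩ := Subalgebra.mem_map.mp hx'
    exact hs hy
  refine ⟨s.image e.symm, hs', ?_⟩
  let g₀ : T ≃ₐ[A] T.map (e.symm : K →ₐ[A] K') := e.symm.subalgebraMap T
  let g : T ≃+* T' := g₀.toRingEquiv.trans (RingEquiv.subsemiringCongr (by rw [hT'])).symm
  have hg : ∀ x : T, ((g x : T') : K') = e.symm x := fun _ => rfl
  set P : Ideal T := Ideal.comap (Subring.inclusion hs) (maximalIdeal OK) with hP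
  set P' : Ideal T' := Ideal.comap (Subring.inclusion hs') (maximalIdeal O) with hP'
  have hPP' : P = P'.comap g.toRingHom := by
    ext x
    simp only [hP, hP', Ideal.mem_comap, RingEquiv.toRingHom_eq_coe, RingHom.coe_coe]
    rw [ValuationSubring.valuation_lt_one_iff, ValuationSubring.valuation_lt_one_iff]
    change OK.valuation (x : K) < 1 ↔ O.valuation ((g x : T') : K') < 1
    rw [hg, valuation_comap_lt_one_iff, hf]
  haveI : P'.IsPrime := Ideal.IsPrime.comap _
  have hmap : Submonoid.map g.toRingHom.toMonoidHom P.primeCompl = P'.primeCompl := by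
    ext y
    constructor
    · rintro ⟨x, hx, rfl⟩
      simpa [Ideal.primeCompl, hPP'] using hx
    · intro hy
      refine ⟨g.symm y, ?_, by simp⟩
      simpa [Ideal.primeCompl, hPP'] using hy
  exact IsRegularLocalRing.of_ringEquiv (R := Localization.AtPrime P)
    (IsLocalization.ringEquivOfRingEquiv (Localization.AtPrime P) (Localization.AtPrime P')
      g hmap)

end OneFractionField

end Literature.AlgebraicGeometry.Resolution
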